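import Mathlib
import Summits.NavierStokesRegularity.NavierStokesRegularity.Theses.FilamentSkeletonRss
import Summits.NavierStokesRegularity.NavierStokesRegularity.Theorems.FilamentSkeletonRssSkeletonEquilibriumStubCredit

/-!
# Crux `SkeletonEquilibrium` (stmt-NavierStokesRegularity-15400) · the birth composition as a tree theorem

The registered birth skeleton `1408794bc945c1e9` (`Cruxes/SkeletonEquilibrium/Lines/birth.lean`, planner
`planner-skel-stmt-NavierStokesRegularity-15400`) proves the crux BY NAME from three registered stubs:
`stub_equilibriumFamilyA1` (XL, OPEN — the analytic core of the crux in its own units: exact relative equilibria of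
the C₄ skew quartet `N = 4`, `γ ≡ 16π`, `α = −1` whose rescaled slips are `ε`-close in `C¹` to the certified rational
model `W` on `|t| ≤ 10` and zero-free beyond), `stub_innerCertificateA1` and `stub_persistence` (both LANDED, re-exported
under their registered names in `…SkeletonEquilibriumStubCredit`).

This file lands that composition with the OPEN stub as an explicit hypothesis:

* `skeletonEquilibrium_of_equilibriumFamilyA1 : (registered signature of stub_equilibriumFamilyA1, VERBATIM, as the
  hypothesis `hfamily`) → SkeletonEquilibrium` — the birth glue
  (`δ = ε = 1/4`; rescaling `t ↦ w_j(√Γ t)/√Γ`, persistence of the certified transversal zero on `[−31/10, −12/5]`,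
  transport of the zero and of the slope `w_j′(τ*) ≥ 2 − 1/4 = 3/2 + 1/4`), adapted from `Lines/birth.lean`
  (`SkeletonEquilibrium_of`) with the two landed stubs invoked by name.

So a landing of `stub_equilibriumFamilyA1` closes the crux by `skeletonEquilibrium_of_equilibriumFamilyA1 h`.
HONEST LABEL: bookkeeping (≈ 60 lines of glue) for a HELD support item, def-free, CONDITIONAL on the open stub (the
audit's `proof.conditional` — it credits nothing); the existence statement is crux-sized and stays OPEN; no summit
statement is proved; Navier–Stokes regularity is not touched.
-/

noncomputable section

-- `Summit.<Summit>.<Problem>`: single-conjunct summit, the duplicate segment is mandated (CONVENTIONS §2).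
set_option linter.dupNamespace false

namespace Summit.NavierStokesRegularity.NavierStokesRegularity.Theorems.SkeletonEquilibrium.Birth

open Set MeasureTheory Filter Topology
open Literature.Analysis.FluidPDE

/-- Rescaling a slip: `t ↦ w (c t) / c` has derivative `w′ (c t)` (from `Lines/birth.lean`). [folklore] -/
theorem deriv_rescale (w : ℝ → ℝ) (c : ℝ) (hc : c ≠ 0) (t : ℝ) :
    deriv (fun s => w (c * s) / c) t = deriv w (c * t) := by
  rw [deriv_div_const, deriv_comp_mul_left c w t, smul_eq_mul]
  field_simp

/-- **Birth composition (conditional).** The crux `FilamentSkeletonRss.SkeletonEquilibrium` from the OPEN registered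
stub `stub_equilibriumFamilyA1` — its signature VERBATIM as the hypothesis `hfamily` (C₄ skew quartet `N = 4`, `γ ≡ 16π`,
`α = −1`: exact relative equilibria at arbitrarily large `Γ` whose rescaled slips are `ε`-close in `C¹` to the certified
rational model `W` on `|t| ≤ 10` and zero-free beyond; research-level, crux-sized) — and the two landed stubs
`stub_innerCertificateA1`, `stub_persistence` (by name): `N = 4`, `γ ≡ 16π`, `α = −1`, `δ = 1/4`, tolerance `ε = 1/4`.
Adapted verbatim from `Cruxes/SkeletonEquilibrium/Lines/birth.lean` (`SkeletonEquilibrium_of`). [folklore] -/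
theorem skeletonEquilibrium_of_equilibriumFamilyA1
    (hfamily : ∀ (W Wd : ℝ → ℝ),
          (∀ t, W t = t / 2 - 11 / 5 + 2400 / (272 * t ^ 2 - 320 * t + 425) + 2400 / (144 * t ^ 2 + 625)
                            + 2400 / (272 * t ^ 2 + 320 * t + 425)) →
          (∀ t, Wd t = 1 / 2 - 2400 * (544 * t - 320) / (272 * t ^ 2 - 320 * t + 425) ^ 2
                            - 2400 * (288 * t) / (144 * t ^ 2 + 625) ^ 2
                            - 2400 * (544 * t + 320) / (272 * t ^ 2 + 320 * t + 425) ^ 2) →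
          ∀ ε : ℝ, 0 < ε → ∃ ρ K : ℝ, 0 < ρ ∧ ∀ Γ₀ : ℝ, ∃ Γ : ℝ, Γ₀ ≤ Γ ∧ 0 < Γ ∧
            ∃ (Ξ : Fin 4 → ℝ → EuclideanSpace ℝ (Fin 3)) (w : Fin 4 → ℝ → ℝ),
              (∀ j, ContDiff ℝ 2 (Ξ j) ∧ Function.Injective (Ξ j) ∧ Differentiable ℝ (w j) ∧
                  (∀ τ, ‖deriv (Ξ j) τ‖ = 1) ∧ (∀ τ, ‖iteratedDeriv 2 (Ξ j) τ‖ * Real.sqrt Γ ≤ K) ∧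
                  Tendsto (fun τ => ‖Ξ j τ‖) atTop atTop ∧ Tendsto (fun τ => ‖Ξ j τ‖) atBot atTop) ∧
              (∀ j k, j ≠ k → ∀ τ σ, ρ * Real.sqrt Γ ≤ ‖Ξ j τ - Ξ k σ‖) ∧
              (∀ j (x : EuclideanSpace ℝ (Fin 3)), Integrable (fun σ : ℝ =>
                  ((‖x - Ξ j σ‖ ^ 2 + 1) ^ (3 / 2 : ℝ))⁻¹ • cross (deriv (Ξ j) σ) (x - Ξ j σ))) ∧
              (∀ j τ, (∑ k : Fin 4, (Γ * (16 * Real.pi) / (4 * Real.pi)) • ∫ σ : ℝ,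
                    ((‖Ξ j τ - Ξ k σ‖ ^ 2 + 1) ^ (3 / 2 : ℝ))⁻¹ • cross (deriv (Ξ k) σ) (Ξ j τ - Ξ k σ))
                  + (1 / 2 : ℝ) • Ξ j τ - (-1 : ℝ) • cross (EuclideanSpace.single (2 : Fin 3) (1 : ℝ)) (Ξ j τ)
                  = w j τ • deriv (Ξ j) τ) ∧
              (∀ j t, |t| ≤ 10 →
                  |w j (Real.sqrt Γ * t) / Real.sqrt Γ - W t| ≤ ε ∧ |deriv (w j) (Real.sqrt Γ * t) - Wd t| ≤ ε) ∧
              (∀ j t, 10 ≤ |t| → w j (Real.sqrt Γ * t) ≠ 0)) :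
    Theses.FilamentSkeletonRss.SkeletonEquilibrium := by
  have hcert := SkeletonEquilibrium.stub_innerCertificateA1
  have hpersist := SkeletonEquilibrium.stub_persistence
  -- the model slip and its derivative, pinned by their defining equations
  let W : ℝ → ℝ := fun t => t / 2 - 11 / 5 + 2400 / (272 * t ^ 2 - 320 * t + 425)
    + 2400 / (144 * t ^ 2 + 625) + 2400 / (272 * t ^ 2 + 320 * t + 425)
  let Wd : ℝ → ℝ := fun t => 1 / 2 - 2400 * (544 * t - 320) / (272 * t ^ 2 - 320 * t + 425) ^ 2
    - 2400 * (288 * t) / (144 * t ^ 2 + 625) ^ 2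
    - 2400 * (544 * t + 320) / (272 * t ^ 2 + 320 * t + 425) ^ 2
  have hW : ∀ t, W t = t / 2 - 11 / 5 + 2400 / (272 * t ^ 2 - 320 * t + 425) + 2400 / (144 * t ^ 2 + 625)
      + 2400 / (272 * t ^ 2 + 320 * t + 425) := fun t => rfl
  have hWd : ∀ t, Wd t = 1 / 2 - 2400 * (544 * t - 320) / (272 * t ^ 2 - 320 * t + 425) ^ 2
      - 2400 * (288 * t) / (144 * t ^ 2 + 625) ^ 2
      - 2400 * (544 * t + 320) / (272 * t ^ 2 + 320 * t + 425) ^ 2 := fun t => rfl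
  -- the certificate and the family at tolerance ε = 1/4
  obtain ⟨hC1, hC2, hC3, hC4⟩ := hcert W Wd hW hWd
  obtain ⟨ρ, K, hρ, hmain⟩ := hfamily W Wd hW hWd (1 / 4) (by norm_num)
  refine ⟨4, fun _ => 16 * Real.pi, -1, 1 / 4, ρ, K, by norm_num, by norm_num, by norm_num, hρ,
    fun _ => mul_ne_zero (by norm_num) Real.pi_ne_zero, ?_⟩
  intro Γ₀
  obtain ⟨Γ, hΓ₀, hΓ, Ξ, w, ha, hb, hc, hd, he, hfar⟩ := hmain Γ₀
  refine ⟨Γ, hΓ₀, hΓ, Ξ, w, ha, hb, hc, hd, ?_⟩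
  intro j
  have hsq : Real.sqrt Γ ≠ 0 := (Real.sqrt_pos.2 hΓ).ne'
  -- the rescaled slip of filament j
  set f : ℝ → ℝ := fun t => w j (Real.sqrt Γ * t) / Real.sqrt Γ with hf_def
  have hwdiff : Differentiable ℝ (w j) := (ha j).2.2.1
  have hfd : Differentiable ℝ f :=
    (hwdiff.comp (differentiable_id.const_mul (Real.sqrt Γ))).div_const _
  have hfderiv : ∀ t, deriv f t = deriv (w j) (Real.sqrt Γ * t) := fun t =>
    deriv_rescale (w j) (Real.sqrt Γ) hsq t
  have hclose : ∀ t, |t| ≤ 10 → |f t - W t| ≤ 1 / 4 ∧ |deriv f t - Wd t| ≤ 1 / 4 := by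
    intro t ht
    obtain ⟨h1, h2⟩ := he j t ht
    exact ⟨h1, by rw [hfderiv]; exact h2⟩
  have hfarf : ∀ t, 10 ≤ |t| → f t ≠ 0 := by
    intro t ht hft
    exact hfar j t ht ((div_eq_zero_iff.1 hft).resolve_right hsq)
  -- persistence: window [−31/10, −12/5], box 10, margin 7/10, slope 2, tolerance 1/4
  obtain ⟨ts, h0, huniq, hslope⟩ :=
    hpersist f W Wd (-31 / 10) (-12 / 5) 10 (7 / 10) 2 (1 / 4) hfd (by norm_num) (by norm_num) (by norm_num)
      (by norm_num) (by norm_num) (by norm_num) hC1 hC2 hC3 hC4 hclose hfarf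
  refine ⟨Real.sqrt Γ * ts, ?_, ?_, ?_⟩
  · -- the zero, transported back to τ = √Γ t
    have : f ts = 0 := h0
    exact (div_eq_zero_iff.1 this).resolve_right hsq
  · -- uniqueness
    intro τ hτ
    have hft : f (τ / Real.sqrt Γ) = 0 := by
      simp only [hf_def, mul_div_cancel₀ τ hsq, hτ, zero_div]
    have := huniq _ hft
    rw [← this, mul_div_cancel₀ τ hsq]
  · -- the slope: w_j′(√Γ ts) = f′(ts) ≥ 2 − 1/4 = 3/2 + 1/4
    have := hfderiv ts
    rw [← this]
    linarith

end Summit.NavierStokesRegularity.NavierStokesRegularity.Theorems.SkeletonEquilibrium.Birth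

end
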